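import Mathlib
import HarnessLib
import Summits.Ventures.LatticeQCDFlow.Scoring.ChainConfidenceInterval
import Summits.Ventures.LatticeQCDFlow.Scoring.FlowSamplerAutocorrelation

/-!
# Gaussian confidence for the exact flow sampler on `SU(n)^E`, from ANY start — UNCONDITIONAL:
# `P(|A_N − πf| ≥ s) ≤ 2 exp(−(N s − 4C'e^{2δ})² / (8 N C'² e^{4δ}))`

HONEST FRAMING: exact (Metropolis-corrected) sampling algorithms for lattice gauge theory;
figures of merit are autocorrelation/cost numbers at stated couplings and volumes; no
continuum-physics claim.

Venture `LatticeQCDFlow` (cell pub-lqcd), topic `Scoring`; FANOUT row 8 (`s0-cpn-nemc`, GEN-13).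
NEW WORK of the cell, not a published result; no definition is introduced.  The composition of
`Scoring/ChainHoeffding.lean` (`chain_abs_tail_le_exp_of_doeblin`: Hoeffding's inequality for a
Markov kernel minorised by its invariant law, from any initial law, via the Poisson-martingale route)
and its inversion `Scoring/ChainConfidenceInterval.lean` (`chain_confidence_of_doeblin`) with the
tree's exact flow-MCMC theorem `Exactness.flowSampler_exact_doeblin` (row 30 / lean-2;
UNCONDITIONAL via `jacobianFormula_holds`: Doeblin constant `e^{−2δ}` from a uniform defect `δ` of
Lüscher's flow equation).  Printed counterpart NAMED ONLY: Glynn–Ormoneit 2002 (uniformly ergodic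
chains); nothing is cited as a fact.

## Content

* **`flowSampler_abs_tail_le_exp`** — under the hypotheses of `Scoring.flowSampler_autocorrelation`
  (smooth `S`, jointly smooth flow action with uniform defect `δ` of Lüscher's equation (4.5) on
  `[0,1] × SU(n)^E`, `𝓕` integrating `−∂S̃_t`, `q = (𝓕_1)_* D[V]`): with the weight `w` of
  `flowSampler_exact_doeblin` (`w · q = π := 𝒵⁻¹e^{−S}D[U]`, `K = indepMH q w` EXACT), for EVERY
  initial law `μ₀` of the chain `U_0, U_1, …` (cold start, hot start, a model draw), every bounded
  measurable `f` (`|f| ≤ C`, `C' = C + |πf|`), every `N ≥ 1` and every `s` with `N s ≥ 4C'e^{2δ}`: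
  `P_{μ₀}(|(1/N) Σ_{i<N} f(U_i) − πf| ≥ s) ≤ 2 exp(−(N s − 4C'e^{2δ})² / (8 N C'² e^{4δ}))`;
* **`flowSampler_confidence`** — the same as a confidence radius: for every `0 < η ≤ 1`,
  `P_{μ₀}(|(1/N) Σ_{i<N} f(U_i) − πf| > 4C'e^{2δ}/N + √(8 C'² e^{4δ} log(2/η)/N)) ≤ η`.

Reading (value-free): a certified flow-equation defect `δ` is, by itself, an honest confidence
interval for every bounded observable of the exact flow sampler at every volume at which `δ` holds —
Gaussian in `N` with rate `s² e^{−4δ}/(8C'²)` per update, no thermalisation cut, no autocorrelation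
estimate.  NOT CLAIMED: any value of `δ` for a concrete flow (theory-1's `TrivializingMaps/*`);
sharpness of the constants; unbounded observables.
-/

noncomputable section

namespace Summit.Ventures.LatticeQCDFlow.Scoring

open MeasureTheory ProbabilityTheory Filter Finset Preorder
open scoped ENNReal NNReal

/-! ### The exact flow sampler on `SU(n)^E` — UNCONDITIONAL, any start -/

section Lattice

open Summit.Ventures.LatticeQCDFlow.Exactness
open Literature.MathematicalPhysics.QuantumFieldTheory
open Literature.MathematicalPhysics.QuantumFieldTheory.Luscher2010
open Summit.Ventures.LatticeQCDFlow.TrivializingMaps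
open scoped Matrix Matrix.Norms.Frobenius ContDiff

variable {d L n : ℕ} [NeZero L]

/-- **Gaussian confidence for the exact flow sampler — UNCONDITIONAL, from any start.**  Under the
hypotheses of `Scoring.flowSampler_autocorrelation` (smooth `S`, jointly smooth flow action with
uniform defect `δ` of Lüscher's equation on `[0,1] × SU(n)^E`, `q = (𝓕_1)_* D[V]`): with the weight
`w` of `flowSampler_exact_doeblin` (`w · q = π`, `K = indepMH q w` EXACT), for EVERY initial law `μ₀`,
every bounded measurable `f` (`|f| ≤ C`, `C' = C + |πf|`), every `N ≥ 1` and `s` with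
`N s ≥ 4C' e^{2δ}`:
`P_{μ₀}(|(1/N) Σ_{i<N} f(U_i) − πf| ≥ s) ≤ 2 exp(−(N s − 4C' e^{2δ})² / (8 N C'² e^{4δ}))`. -/
theorem flowSampler_abs_tail_le_exp (B : SuBasis n)
    {S : AmbConfig d L n → ℝ} (hS : ContDiff ℝ ∞ S) {F : ℝ → AmbConfig d L n → ℝ}
    (hF : ContDiff ℝ ∞ fun p : ℝ × AmbConfig d L n => F p.1 p.2)
    {Φ : ℝ → GaugeConfig d L (Matrix.specialUnitaryGroup (Fin n) ℂ) →
      GaugeConfig d L (Matrix.specialUnitaryGroup (Fin n) ℂ)}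
    (hΦ : IsFlowMap (fun t W => -linkGrad B (F t) W) Φ) {c : ℝ → ℝ} {δ : ℝ}
    (hδ : ∀ t ∈ Set.Icc (0 : ℝ) 1, ∀ U : GaugeConfig d L (Matrix.specialUnitaryGroup (Fin n) ℂ),
      |luscherL B S t (F t) (WilsonFlow.coeConfig U) - S (WilsonFlow.coeConfig U) - c t| ≤ δ)
    (q : Measure (GaugeConfig d L (Matrix.specialUnitaryGroup (Fin n) ℂ))) [IsProbabilityMeasure q]
    (hq : q = Measure.map (Φ 1) (trivialMeasure (Matrix.specialUnitaryGroup (Fin n) ℂ) d L)) :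
    ∃ w : GaugeConfig d L (Matrix.specialUnitaryGroup (Fin n) ℂ) → ℝ, ∃ hw : Measurable w,
      (q.withDensity fun U => ENNReal.ofReal (w U)) =
        boltzmannMeasure (fun U : GaugeConfig d L (Matrix.specialUnitaryGroup (Fin n) ℂ) =>
          S (WilsonFlow.coeConfig U)) ∧
      Kernel.Invariant (indepMH q w)
        (boltzmannMeasure fun U : GaugeConfig d L (Matrix.specialUnitaryGroup (Fin n) ℂ) =>
          S (WilsonFlow.coeConfig U)) ∧
      ∀ (μ₀ : Measure (GaugeConfig d L (Matrix.specialUnitaryGroup (Fin n) ℂ))) [IsProbabilityMeasure μ₀]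
        (f : GaugeConfig d L (Matrix.specialUnitaryGroup (Fin n) ℂ) → ℝ), Measurable f →
        ∀ C : ℝ, (∀ U, |f U| ≤ C) → ∀ N : ℕ, N ≠ 0 → ∀ s : ℝ,
        let π := boltzmannMeasure fun U : GaugeConfig d L (Matrix.specialUnitaryGroup (Fin n) ℂ) =>
          S (WilsonFlow.coeConfig U)
        4 * (C + |∫ V, f V ∂π|) * Real.exp (2 * δ) ≤ N * s →
        haveI : Fact (Measurable w) := ⟨hw⟩
        (Kernel.trajMeasure (X := fun _ : ℕ => GaugeConfig d L (Matrix.specialUnitaryGroup (Fin n) ℂ))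
              μ₀ (fun m : ℕ => (indepMH q w).comap
                (fun y : (i : ↥(Finset.Iic m)) → GaugeConfig d L (Matrix.specialUnitaryGroup (Fin n) ℂ) =>
                  y ⟨m, Finset.mem_Iic.2 le_rfl⟩) (measurable_pi_apply _))).real
            {x | s ≤ |(∑ i ∈ Finset.range N, f (x i)) / N - ∫ V, f V ∂π|}
          ≤ 2 * Real.exp (-(N * s - 4 * (C + |∫ V, f V ∂π|) * Real.exp (2 * δ)) ^ 2
              / (8 * N * (C + |∫ V, f V ∂π|) ^ 2 * Real.exp (4 * δ))) := by
  obtain ⟨w, hw, -, -, hπ, hinv, -, hdoeb⟩ := flowSampler_exact_doeblin B hS hF hΦ hδ q hq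
  haveI : Fact (Measurable w) := ⟨hw⟩
  have hS'c : Continuous fun U : GaugeConfig d L (Matrix.specialUnitaryGroup (Fin n) ℂ) =>
      S (WilsonFlow.coeConfig U) := hS.continuous.comp WilsonFlow.continuous_coeConfig
  haveI := isProbabilityMeasure_boltzmannMeasure (d := d) (L := L) hS'c
  have hε0 : 0 < ENNReal.ofReal (Real.exp (-(2 * δ))) := ENNReal.ofReal_pos.2 (Real.exp_pos _)
  refine ⟨w, hw, hπ, hinv, fun μ₀ _ f hf C hC N hN s hs => ?_⟩
  have hr : (ENNReal.ofReal (Real.exp (-(2 * δ)))).toReal = Real.exp (-(2 * δ)) :=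
    ENNReal.toReal_ofReal (Real.exp_pos _).le
  have h4 : 4 * (C + |∫ V, f V ∂(boltzmannMeasure fun U : GaugeConfig d L
        (Matrix.specialUnitaryGroup (Fin n) ℂ) => S (WilsonFlow.coeConfig U))|)
        / (ENNReal.ofReal (Real.exp (-(2 * δ)))).toReal
      = 4 * (C + |∫ V, f V ∂(boltzmannMeasure fun U : GaugeConfig d L
        (Matrix.specialUnitaryGroup (Fin n) ℂ) => S (WilsonFlow.coeConfig U))|) * Real.exp (2 * δ) := by
    rw [hr, Real.exp_neg, div_inv_eq_mul]
  have hs' := hs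
  rw [← h4] at hs'
  have h := chain_abs_tail_le_exp_of_doeblin (κ := indepMH q w) (μ₀ := μ₀) hinv
    (fun x B hB => hdoeb x hB) hε0 hf hC hN hs'
  have h8 : (ENNReal.ofReal (Real.exp (-(2 * δ)))).toReal ^ 2 = (Real.exp (4 * δ))⁻¹ := by
    rw [hr, ← Real.exp_nat_mul, ← Real.exp_neg]
    congr 1
    push_cast
    ring
  rw [h4, h8, div_inv_eq_mul] at h
  exact h

/-- **Confidence radius for the exact flow sampler — UNCONDITIONAL, from any start.**  Under the
same hypotheses, for EVERY initial law `μ₀`, every bounded measurable `f` (`|f| ≤ C`,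
`C' = C + |πf|`), every `N ≥ 1` and every `0 < η ≤ 1`:
`P_{μ₀}(|(1/N) Σ_{i<N} f(U_i) − πf| > 4C'e^{2δ}/N + √(8 C'² e^{4δ} log(2/η)/N)) ≤ η`. -/
theorem flowSampler_confidence (B : SuBasis n)
    {S : AmbConfig d L n → ℝ} (hS : ContDiff ℝ ∞ S) {F : ℝ → AmbConfig d L n → ℝ}
    (hF : ContDiff ℝ ∞ fun p : ℝ × AmbConfig d L n => F p.1 p.2)
    {Φ : ℝ → GaugeConfig d L (Matrix.specialUnitaryGroup (Fin n) ℂ) →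
      GaugeConfig d L (Matrix.specialUnitaryGroup (Fin n) ℂ)}
    (hΦ : IsFlowMap (fun t W => -linkGrad B (F t) W) Φ) {c : ℝ → ℝ} {δ : ℝ}
    (hδ : ∀ t ∈ Set.Icc (0 : ℝ) 1, ∀ U : GaugeConfig d L (Matrix.specialUnitaryGroup (Fin n) ℂ),
      |luscherL B S t (F t) (WilsonFlow.coeConfig U) - S (WilsonFlow.coeConfig U) - c t| ≤ δ)
    (q : Measure (GaugeConfig d L (Matrix.specialUnitaryGroup (Fin n) ℂ))) [IsProbabilityMeasure q]
    (hq : q = Measure.map (Φ 1) (trivialMeasure (Matrix.specialUnitaryGroup (Fin n) ℂ) d L)) :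
    ∃ w : GaugeConfig d L (Matrix.specialUnitaryGroup (Fin n) ℂ) → ℝ, ∃ hw : Measurable w,
      (q.withDensity fun U => ENNReal.ofReal (w U)) =
        boltzmannMeasure (fun U : GaugeConfig d L (Matrix.specialUnitaryGroup (Fin n) ℂ) =>
          S (WilsonFlow.coeConfig U)) ∧
      Kernel.Invariant (indepMH q w)
        (boltzmannMeasure fun U : GaugeConfig d L (Matrix.specialUnitaryGroup (Fin n) ℂ) =>
          S (WilsonFlow.coeConfig U)) ∧
      ∀ (μ₀ : Measure (GaugeConfig d L (Matrix.specialUnitaryGroup (Fin n) ℂ))) [IsProbabilityMeasure μ₀]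
        (f : GaugeConfig d L (Matrix.specialUnitaryGroup (Fin n) ℂ) → ℝ), Measurable f →
        ∀ C : ℝ, (∀ U, |f U| ≤ C) → ∀ N : ℕ, N ≠ 0 → ∀ η : ℝ, 0 < η → η ≤ 1 →
        let π := boltzmannMeasure fun U : GaugeConfig d L (Matrix.specialUnitaryGroup (Fin n) ℂ) =>
          S (WilsonFlow.coeConfig U)
        haveI : Fact (Measurable w) := ⟨hw⟩
        (Kernel.trajMeasure (X := fun _ : ℕ => GaugeConfig d L (Matrix.specialUnitaryGroup (Fin n) ℂ))
              μ₀ (fun m : ℕ => (indepMH q w).comap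
                (fun y : (i : ↥(Finset.Iic m)) → GaugeConfig d L (Matrix.specialUnitaryGroup (Fin n) ℂ) =>
                  y ⟨m, Finset.mem_Iic.2 le_rfl⟩) (measurable_pi_apply _))).real
            {x | 4 * (C + |∫ V, f V ∂π|) * Real.exp (2 * δ) / N
                  + Real.sqrt (8 * (C + |∫ V, f V ∂π|) ^ 2 * Real.exp (4 * δ) * Real.log (2 / η) / N)
                < |(∑ i ∈ Finset.range N, f (x i)) / N - ∫ V, f V ∂π|}
          ≤ η := by
  obtain ⟨w, hw, -, -, hπ, hinv, -, hdoeb⟩ := flowSampler_exact_doeblin B hS hF hΦ hδ q hq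
  haveI : Fact (Measurable w) := ⟨hw⟩
  have hS'c : Continuous fun U : GaugeConfig d L (Matrix.specialUnitaryGroup (Fin n) ℂ) =>
      S (WilsonFlow.coeConfig U) := hS.continuous.comp WilsonFlow.continuous_coeConfig
  haveI := isProbabilityMeasure_boltzmannMeasure (d := d) (L := L) hS'c
  have hε0 : 0 < ENNReal.ofReal (Real.exp (-(2 * δ))) := ENNReal.ofReal_pos.2 (Real.exp_pos _)
  refine ⟨w, hw, hπ, hinv, fun μ₀ _ f hf C hC N hN η hη0 hη1 => ?_⟩
  have h := chain_confidence_of_doeblin (κ := indepMH q w) (μ₀ := μ₀) hinv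
    (fun x B hB => hdoeb x hB) hε0 hf hC hN hη0 hη1
  have hr : (ENNReal.ofReal (Real.exp (-(2 * δ)))).toReal = Real.exp (-(2 * δ)) :=
    ENNReal.toReal_ofReal (Real.exp_pos _).le
  have hNne : (N : ℝ) ≠ 0 := by exact_mod_cast hN
  have he0 : Real.exp (2 * δ) ≠ 0 := (Real.exp_pos _).ne'
  have h1 : 4 * (C + |∫ V, f V ∂(boltzmannMeasure fun U : GaugeConfig d L
        (Matrix.specialUnitaryGroup (Fin n) ℂ) => S (WilsonFlow.coeConfig U))|)
        / ((ENNReal.ofReal (Real.exp (-(2 * δ)))).toReal * N)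
      = 4 * (C + |∫ V, f V ∂(boltzmannMeasure fun U : GaugeConfig d L
        (Matrix.specialUnitaryGroup (Fin n) ℂ) => S (WilsonFlow.coeConfig U))|) * Real.exp (2 * δ) / N := by
    rw [hr, Real.exp_neg]
    field_simp
  have h2 : 8 * (C + |∫ V, f V ∂(boltzmannMeasure fun U : GaugeConfig d L
        (Matrix.specialUnitaryGroup (Fin n) ℂ) => S (WilsonFlow.coeConfig U))|) ^ 2 * Real.log (2 / η)
        / ((ENNReal.ofReal (Real.exp (-(2 * δ)))).toReal ^ 2 * N)
      = 8 * (C + |∫ V, f V ∂(boltzmannMeasure fun U : GaugeConfig d L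
        (Matrix.specialUnitaryGroup (Fin n) ℂ) => S (WilsonFlow.coeConfig U))|) ^ 2 * Real.exp (4 * δ)
          * Real.log (2 / η) / N := by
    have he : Real.exp (-(2 * δ)) ^ 2 = (Real.exp (4 * δ))⁻¹ := by
      rw [sq, ← Real.exp_add, ← Real.exp_neg]
      congr 1
      ring
    rw [hr, he]
    have he4 : Real.exp (4 * δ) ≠ 0 := (Real.exp_pos _).ne'
    field_simp
  rw [h1, h2] at h
  exact h

end Lattice

end Summit.Ventures.LatticeQCDFlow.Scoring

end
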